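import Summits.BirchSwinnertonDyer.BirchSwinnertonDyer.Theorems.BiquadraticEisensteinDescentHeegnerTwistCouplingInSupplySqrtSevenCornerInstance
import Literature.NumberTheory.EllipticCurves.X049TwistFamily
import HarnessLib

set_option linter.dupNamespace false -- `Summit.BirchSwinnertonDyer.BirchSwinnertonDyer.Theorems.…` (summit = sub)
set_option autoImplicit false

/-!
# Crux `HeegnerTwistCouplingInSupply` (stmt-BirchSwinnertonDyer-21381) — the `j = −3375` CORNER with the Deuring–Hecke binder DISCHARGED:
# Burungale–Tian + ONE printed sign rule (the group order formula of `X₀(49)`), Hecke's continuation in the kernel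

Sequel to `…SqrtSevenCorner` / `…SqrtSevenCornerInstance` (w1 g11).  There the `j = −3375` corner — for EVERY prime `p ≡ 3, 19, 27 (mod 56)` and
`W_p = X₀(49)^{(−p)} : y² + xy = x³ − ((21p+1)/4)x² + 7p²x`, a Heegner field `K′` of `N(W_p)` with `4 < |d_{K′}|`, `L(W_p^{(d_{K′})}, 1) ≠ 0`,
`h(K′) < p`, `p ∤ h(K′)` (the CONCLUSION of crux 21381 at `W = W_p`) — was proved modulo TWO named facts: Burungale–Tian (`hBT`) and the
Deuring–Hecke continuation `hH : hasEntireLFunction_of_j_mem_maximalCMJInvariants` (Silverman, *Advanced Topics*, II Cor. 10.5.1: `L(E, s)` is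
entire for `E/ℚ` with CM by a maximal order), the latter used only to read `r_an(A_n) = 0` as `L(A_n, 1) ≠ 0` on the cell curves
`A_n : y² = x(x² + 21nx + 112n²)` (`j = −3375`).

The Literature chain `QuadraticFields/OmegaNegSevenHeckeSums` → `EllipticCurves/X049FrobeniusTraces` → `X049HeckeCoefficients` → `X049ThetaDictionary`
→ `X049TwistFamily` (this seat) proves `W.HasEntireLFunction` for EVERY elliptic `W/ℚ` with `j(W) = −3375` by Hecke's weight-one theta series of
`ℤ[½(1+√−7)]` IN THE KERNEL (`X049.hasEntireLFunction_of_j_eq_neg3375`), modulo ONE printed identity: the group order formula of `X₀(49) = 49a1`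
at the primes `4p = u² + 7v²`, `#E(𝔽_p) = p + 1 − (2u/7)·u` (`X049.groupOrder_A7`; Silverberg 2010 (2.1) = Rajwade 1977 Thm. 3 — of which the tree
proves everything but the SIGN of `u`, `Deuring1941_frobeniusTrace_eq_add_conj_holds`).  This file reruns the corner with `hH` replaced by that
sign rule:

* `hasEntireLFunction_A_of_groupOrder` — `L(A_n, s)` is entire (the leaf, on the cell family);
* `L_one_ne_zero_A_of_groupOrder`, `corner_of_witness_of_groupOrder` — the cell's `L(A_n, 1) ≠ 0` and the witness packaging;
* ★★★ `cruxOnSqrtSevenCorner_of_BT_of_groupOrder` — the corner for every prime `p ≥ 5`, `p ≡ 3 (mod 8)`, `p ≡ 3, 5, 6 (mod 7)`, MODULO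
  Burungale–Tian and `groupOrder_A7` only;
* ★★ `heegnerTwistCouplingInSupply_on_W_of_BT_of_groupOrder` — crux 21381 VERBATIM on `W = W_p` under the same two facts.

HONEST FRAMING: a corner on ONE CM family (measure zero in «all CM `W`»); crux 21381 itself (all CM `W`) is NOT closed; `C⁺` untouched; the
Birch–Swinnerton-Dyer conjecture is not proved by any of this.

## References
* A. Burungale, Y. Tian, *The even parity Goldfeld conjecture: congruent number elliptic curves*, Thm. 1.1. [BurungaleTian2026]
* A. Silverberg, Contemp. Math. 521 (2010), (2.1) and Table 1. [Silverberg2010]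
* A. R. Rajwade, J. Austral. Math. Soc. A 24 (1977), Thm. 3, Thm. 4. [Rajwade1977]
* J. H. Silverman, *Advanced Topics* (1994), II Cor. 10.5.1 (the leaf discharged here). [SilvermanATAEC1994]
-/

noncomputable section

open scoped Classical NumberField

namespace Summit.BirchSwinnertonDyer.BirchSwinnertonDyer.Theorems.BiquadraticEisensteinDescentHeegnerTwistCouplingInSupplySqrtSevenCornerHecke

open _root_.WeierstrassCurve Literature.NumberTheory.EllipticCurves Literature.NumberTheory Literature.NumberTheory.EllipticCurves.Rank1Residual
open IsDedekindDomain Rat.HeightOneSpectrum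
open Summit.BirchSwinnertonDyer.BirchSwinnertonDyer.Theorems.BiquadraticEisensteinDescentHeegnerTwistCouplingInSupplySqrtSevenCell
open Summit.BirchSwinnertonDyer.BirchSwinnertonDyer.Theorems.BiquadraticEisensteinDescentHeegnerTwistCouplingInSupplySqrtSevenPin
open Summit.BirchSwinnertonDyer.BirchSwinnertonDyer.Theorems.BiquadraticEisensteinDescentHeegnerTwistCouplingInSupplySqrtSevenCorner
open Summit.BirchSwinnertonDyer.BirchSwinnertonDyer.Theorems.BiquadraticEisensteinDescentHeegnerTwistCouplingInSupplySqrtSevenCornerInstance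

/-! ## §1 The Deuring–Hecke leaf on the cell family `A_n`, from the group order formula -/

/-- **`L(A_n, s)` is entire**, `A_n : y² = x(x² + 21nx + 112n²)` (`n ≠ 0`; `j(A_n) = −3375`), MODULO the group order formula `groupOrder_A7` of `X₀(49)`
— by `X049.hasEntireLFunction_of_j_eq_neg3375` (Hecke's theta series of `ℤ[½(1+√−7)]` in the kernel) and `j_A`. [cite: Rajwade1977, Thm 4 and Thm 6]
[cite: Silverberg2010, (2.1)] -/
theorem hasEntireLFunction_A_of_groupOrder (hG : X049.groupOrder_A7) {n : ℕ} (hn : n ≠ 0)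
    [hE : (⟨0, 21 * (n : ℚ), 0, 112 * (n : ℚ) ^ 2, 0⟩ : WeierstrassCurve ℚ).IsElliptic] :
    (⟨0, 21 * (n : ℚ), 0, 112 * (n : ℚ) ^ 2, 0⟩ : WeierstrassCurve ℚ).HasEntireLFunction :=
  X049.hasEntireLFunction_of_j_eq_neg3375 hG _ (j_A hn)

variable {q m : ℕ}

/-- ★ **CELL-√7, `L`-form, from Burungale–Tian and the group order formula**: `r_an(A_n) = 0` and `L(A_n, 1) ≠ 0` for `n = qm` in the cell
(`…SqrtSevenCorner.L_one_ne_zero_A` with `hH` replaced by `hasEntireLFunction_A_of_groupOrder`). [cite: BurungaleTian2026, Thm. 1.1] [cite: Silverberg2010, (2.1)] -/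
theorem L_one_ne_zero_A_of_groupOrder (hBT : burungaleTian_analyticRank_eq_zero_of_selmerCorank_eq_zero_of_hasCM) (hG : X049.groupOrder_A7)
    (hq : q.Prime) (hq8 : q % 8 = 3) (hq7 : q % 7 = 3 ∨ q % 7 = 5 ∨ q % 7 = 6) (hm0 : 0 < m) (hmsq : Squarefree m) (hqm : ¬ q ∣ m)
    (hm : ∀ r : ℕ, r.Prime → r ∣ m → r % 4 = 1 ∧ (r % 7 = 3 ∨ r % 7 = 5 ∨ r % 7 = 6))
    [hE : (⟨0, 21 * ((q * m : ℕ) : ℚ), 0, 112 * ((q * m : ℕ) : ℚ) ^ 2, 0⟩ : WeierstrassCurve ℚ).IsElliptic] :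
    (⟨0, 21 * ((q * m : ℕ) : ℚ), 0, 112 * ((q * m : ℕ) : ℚ) ^ 2, 0⟩ : WeierstrassCurve ℚ).analyticRank = 0 ∧
      (⟨0, 21 * ((q * m : ℕ) : ℚ), 0, 112 * ((q * m : ℕ) : ℚ) ^ 2, 0⟩ : WeierstrassCurve ℚ).entireLFunction 1 ≠ 0 := by
  haveI : Fact (Nat.Prime 2) := ⟨Nat.prime_two⟩
  have hn0 : (q * m : ℕ) ≠ 0 := Nat.mul_ne_zero hq.ne_zero hm0.ne'
  obtain ⟨-, hCM⟩ := j_A_mem_and_hasCM hn0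
  have h0 := hBT _ hCM 2 (selmerCorank_two_eq_zero hq hq8 hq7 hm0 hmsq hqm hm)
  exact ⟨h0, (analyticRank_eq_zero_iff_holds (W := (⟨0, 21 * ((q * m : ℕ) : ℚ), 0, 112 * ((q * m : ℕ) : ℚ) ^ 2, 0⟩ :
    WeierstrassCurve ℚ)) (hasEntireLFunction_A_of_groupOrder hG hn0)).1 h0⟩

/-! ## §2 ★★★ The corner: every prime `p ≡ 3, 19, 27 (mod 56)`, modulo Burungale–Tian + the group order formula -/

/-- The data of a corner witness from a pinned prime `ℓ` and its field, under Burungale–Tian + the group order formula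
(`…SqrtSevenCorner.corner_of_witness` with `hH` replaced). [cite: BurungaleTian2026, Thm. 1.1] [cite: Silverberg2010, (2.1)] -/
theorem corner_of_witness_of_groupOrder (hBT : burungaleTian_analyticRank_eq_zero_of_selmerCorank_eq_zero_of_hasCM) (hG : X049.groupOrder_A7)
    {p : ℕ} (hp : p.Prime) (hp8 : p % 8 = 3) (hp7 : p % 7 = 3 ∨ p % 7 = 5 ∨ p % 7 = 6) {ℓ : ℕ} {K : Type} [Field K] [NumberField K]
    (hℓ : ℓ.Prime) (hℓ4 : ℓ % 4 = 1) (hℓ7 : ℓ % 7 = 3 ∨ ℓ % 7 = 5 ∨ ℓ % 7 = 6) (hℓp : ℓ ≠ p) (hK : IsImaginaryQuadratic K)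
    (hdK : NumberField.discr K = -(4 * (ℓ : ℤ)))
    (hHg : SatisfiesHeegnerHypothesis ((⟨1, -(((21 * p + 1) / 4 : ℕ) : ℚ), 0, 7 * (p : ℚ) ^ 2, 0⟩ : WeierstrassCurve ℚ).conductorNorm ℤ) K)
    (hcl : NumberField.classNumber K < p) :
    ∃ (K : Type) (_ : Field K) (_ : NumberField K),
      IsImaginaryQuadratic K ∧ 4 < (NumberField.discr K).natAbs ∧
      SatisfiesHeegnerHypothesis ((⟨1, -(((21 * p + 1) / 4 : ℕ) : ℚ), 0, 7 * (p : ℚ) ^ 2, 0⟩ : WeierstrassCurve ℚ).conductorNorm ℤ) K ∧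
      ((⟨1, -(((21 * p + 1) / 4 : ℕ) : ℚ), 0, 7 * (p : ℚ) ^ 2, 0⟩ : WeierstrassCurve ℚ).quadraticTwist
        (NumberField.discr K : ℚ)).entireLFunction 1 ≠ 0 ∧
      NumberField.classNumber K < p ∧ ¬ p ∣ NumberField.classNumber K := by
  refine ⟨K, inferInstance, inferInstance, hK, ?_, hHg, ?_, hcl, fun hdvd =>
    absurd (Nat.le_of_dvd (NumberField.classNumber_pos K) hdvd) (not_le.mpr hcl)⟩
  · rw [hdK, Int.natAbs_neg, show (4 * (ℓ : ℤ)) = ((4 * ℓ : ℕ) : ℤ) by push_cast; ring, Int.natAbs_natCast]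
    have := hℓ.two_le
    omega
  · -- `W_p^{(−4ℓ)} = A_{pℓ}` is in CELL-√7 with `q = p`, `m = ℓ`
    rw [hdK, quadraticTwist_W p ℓ (by omega)]
    have hpℓ : ¬ p ∣ ℓ := fun h => hℓp ((Nat.prime_dvd_prime_iff_eq hp hℓ).mp h).symm
    haveI := isElliptic_A (Nat.mul_ne_zero hp.ne_zero hℓ.ne_zero)
    exact (L_one_ne_zero_A_of_groupOrder hBT hG hp hp8 hp7 hℓ.pos hℓ.squarefree hpℓ (fun r hr hrℓ => by
      rw [(Nat.prime_dvd_prime_iff_eq hr hℓ).mp hrℓ]; exact ⟨hℓ4, hℓ7⟩)).2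

/-- ★★★ **THE `j = −3375` CORNER, modulo Burungale–Tian and the group order formula of `X₀(49)` ONLY.**  For EVERY prime `p ≥ 5`,
`p ≡ 3 (mod 8)`, `p ≡ 3, 5, 6 (mod 7)` and `W = W_p : y² + xy = x³ − ((21p+1)/4) x² + 7p² x` (`= X₀(49)^{(−p)}`, `j = −3375`, additive at `p`): there
is an imaginary quadratic field `K′` with `4 < |d_{K′}|`, Heegner for `N(W_p)`, `L(W_p^{(d_{K′})}, 1) ≠ 0`, `h(K′) < p` and `p ∤ h(K′)` — the
CONCLUSION of crux 21381 at `W = W_p` — with the Deuring–Hecke binder `hH` of `cruxOnSqrtSevenCorner_of_two_facts` replaced by the one printed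
sign rule `X049.groupOrder_A7` (Silverberg 2010 (2.1) = Rajwade 1977 Thm. 3), Hecke's continuation being a kernel theorem
(`X049.hasEntireLFunction_of_j_eq_neg3375`). [cite: BurungaleTian2026, Thm. 1.1] [cite: Silverberg2010, (2.1)] [cite: Rajwade1977, Thm 3 and Thm 4]
[cite: SilvermanAEC2009, Prop. X.4.9 and Thm. X.4.2(a)] [cite: Oesterle1988Gauss, II §3 Proposition p. 57 (27)] -/
theorem cruxOnSqrtSevenCorner_of_BT_of_groupOrder (hBT : burungaleTian_analyticRank_eq_zero_of_selmerCorank_eq_zero_of_hasCM)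
    (hG : X049.groupOrder_A7) :
    ∀ (p : ℕ) [Fact p.Prime], 5 ≤ p → p % 8 = 3 → (p % 7 = 3 ∨ p % 7 = 5 ∨ p % 7 = 6) →
      ∃ (K : Type) (_ : Field K) (_ : NumberField K),
        IsImaginaryQuadratic K ∧ 4 < (NumberField.discr K).natAbs ∧
        SatisfiesHeegnerHypothesis ((⟨1, -(((21 * p + 1) / 4 : ℕ) : ℚ), 0, 7 * (p : ℚ) ^ 2, 0⟩ : WeierstrassCurve ℚ).conductorNorm ℤ) K ∧
        ((⟨1, -(((21 * p + 1) / 4 : ℕ) : ℚ), 0, 7 * (p : ℚ) ^ 2, 0⟩ : WeierstrassCurve ℚ).quadraticTwist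
          (NumberField.discr K : ℚ)).entireLFunction 1 ≠ 0 ∧
        NumberField.classNumber K < p ∧ ¬ p ∣ NumberField.classNumber K := by
  intro p hpF hp5 hp8 hp7
  have hp : p.Prime := hpF.out
  haveI := isElliptic_W p hp (by omega)
  have hN : ∀ r : ℕ, r.Prime → r ∣ (⟨1, -(((21 * p + 1) / 4 : ℕ) : ℚ), 0, 7 * (p : ℚ) ^ 2, 0⟩ : WeierstrassCurve ℚ).conductorNorm ℤ →
      r = 7 ∨ r = p := fun r hr h => eq_seven_or_eq_of_prime_dvd_conductorNorm_W hp (by omega) hr h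
  by_cases h23 : 23 ≤ p
  · obtain ⟨ℓ, K, iF, iN, hℓ, hℓ4, hℓ7, -, hℓp, -, hK, hdK, hHg, hcl⟩ := exists_sqrtSevenPin_witnessField hp hp8 h23 hN
    exact corner_of_witness_of_groupOrder hBT hG hp hp8 hp7 hℓ hℓ4 hℓ7 hℓp hK hdK hHg hcl
  · -- below `23`, the only prime `5 ≤ p ≡ 3, 19, 27 (mod 56)` is `19`; its witness is `ℓ = 13`, `K′ = ℚ(√−13)`, `h = 2`
    obtain rfl : p = 19 := by omega
    obtain ⟨ℓ, K, iF, iN, hℓ, hℓ4, hℓ7, -, hℓp, -, hK, hdK, hHg, hcl⟩ := exists_sqrtSevenPin_witnessField_nineteen hN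
    exact corner_of_witness_of_groupOrder hBT hG hp hp8 hp7 hℓ hℓ4 hℓ7 hℓp hK hdK hHg hcl

/-- The corner in the shape of crux 21381's consequent (dropping `h(K′) < p`). [cite: BurungaleTian2026, Thm. 1.1] [cite: Silverberg2010, (2.1)] -/
theorem cruxOnSqrtSevenCorner_of_groupOrder (hBT : burungaleTian_analyticRank_eq_zero_of_selmerCorank_eq_zero_of_hasCM)
    (hG : X049.groupOrder_A7) {p : ℕ} [Fact p.Prime] (hp5 : 5 ≤ p) (hp8 : p % 8 = 3) (hp7 : p % 7 = 3 ∨ p % 7 = 5 ∨ p % 7 = 6) :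
    ∃ (K : Type) (_ : Field K) (_ : NumberField K), IsImaginaryQuadratic K ∧ 4 < (NumberField.discr K).natAbs ∧
      SatisfiesHeegnerHypothesis ((⟨1, -(((21 * p + 1) / 4 : ℕ) : ℚ), 0, 7 * (p : ℚ) ^ 2, 0⟩ : WeierstrassCurve ℚ).conductorNorm ℤ) K ∧
      ((⟨1, -(((21 * p + 1) / 4 : ℕ) : ℚ), 0, 7 * (p : ℚ) ^ 2, 0⟩ : WeierstrassCurve ℚ).quadraticTwist
        (NumberField.discr K : ℚ)).entireLFunction 1 ≠ 0 ∧
      ¬ p ∣ NumberField.classNumber K := by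
  obtain ⟨K, iF, iN, hK, h4, hHg, hL, -, hndvd⟩ := cruxOnSqrtSevenCorner_of_BT_of_groupOrder hBT hG p hp5 hp8 hp7
  exact ⟨K, iF, iN, hK, h4, hHg, hL, hndvd⟩

/-! ## §3 ★★ Crux 21381 verbatim on `W = W_p`, modulo Burungale–Tian + the group order formula -/

/-- ★★ **Crux 21381 verbatim on the family**, with the Deuring–Hecke binder discharged: for every prime `p` with `p ≡ 3 (mod 8)`,
`p ≡ 3, 5, 6 (mod 7)` and `W = W_p`, the implication `HeegnerTwistCouplingInSupply` (binders `IsElliptic`, `IsGloballyMinimal`, `Fact p.Prime`,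
`NeZero N`; hypotheses `HasCM → r_an = 1 → 5 ≤ p → CMInert → ¬ Good → supply → ∃ K′ …`) HOLDS, modulo Burungale–Tian and `X049.groupOrder_A7`
(`…CornerInstance.heegnerTwistCouplingInSupply_on_W` with `hH` replaced).  The crux itself (ALL CM `W`) is not closed by this; BSD is not proved by this.
[cite: BurungaleTian2026, Thm. 1.1] [cite: Silverberg2010, (2.1)] -/
theorem heegnerTwistCouplingInSupply_on_W_of_BT_of_groupOrder (hBT : burungaleTian_analyticRank_eq_zero_of_selmerCorank_eq_zero_of_hasCM)
    (hG : X049.groupOrder_A7) {p : ℕ} (hp8 : p % 8 = 3) (hp7 : p % 7 = 3 ∨ p % 7 = 5 ∨ p % 7 = 6)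
    [Fact p.Prime] [(⟨1, -(((21 * p + 1) / 4 : ℕ) : ℚ), 0, 7 * (p : ℚ) ^ 2, 0⟩ : WeierstrassCurve ℚ).IsElliptic]
    [(⟨1, -(((21 * p + 1) / 4 : ℕ) : ℚ), 0, 7 * (p : ℚ) ^ 2, 0⟩ : WeierstrassCurve ℚ).IsGloballyMinimal]
    [NeZero ((⟨1, -(((21 * p + 1) / 4 : ℕ) : ℚ), 0, 7 * (p : ℚ) ^ 2, 0⟩ : WeierstrassCurve ℚ).conductorNorm ℤ)] :
    (⟨1, -(((21 * p + 1) / 4 : ℕ) : ℚ), 0, 7 * (p : ℚ) ^ 2, 0⟩ : WeierstrassCurve ℚ).HasCM →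
    (⟨1, -(((21 * p + 1) / 4 : ℕ) : ℚ), 0, 7 * (p : ℚ) ^ 2, 0⟩ : WeierstrassCurve ℚ).analyticRank = 1 → 5 ≤ p →
    CMInert (⟨1, -(((21 * p + 1) / 4 : ℕ) : ℚ), 0, 7 * (p : ℚ) ^ 2, 0⟩ : WeierstrassCurve ℚ) p →
    ¬ Good (⟨1, -(((21 * p + 1) / 4 : ℕ) : ℚ), 0, 7 * (p : ℚ) ^ 2, 0⟩ : WeierstrassCurve ℚ) p →
    (∀ B : ℕ, ∃ (K : Type) (_ : Field K) (_ : NumberField K), IsImaginaryQuadratic K ∧ B < (NumberField.discr K).natAbs ∧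
      4 < (NumberField.discr K).natAbs ∧
      SatisfiesHeegnerHypothesis ((⟨1, -(((21 * p + 1) / 4 : ℕ) : ℚ), 0, 7 * (p : ℚ) ^ 2, 0⟩ : WeierstrassCurve ℚ).conductorNorm ℤ) K ∧
      ¬ p ∣ NumberField.classNumber K) →
    ∃ (K : Type) (_ : Field K) (_ : NumberField K), IsImaginaryQuadratic K ∧ 4 < (NumberField.discr K).natAbs ∧
      SatisfiesHeegnerHypothesis ((⟨1, -(((21 * p + 1) / 4 : ℕ) : ℚ), 0, 7 * (p : ℚ) ^ 2, 0⟩ : WeierstrassCurve ℚ).conductorNorm ℤ) K ∧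
      ((⟨1, -(((21 * p + 1) / 4 : ℕ) : ℚ), 0, 7 * (p : ℚ) ^ 2, 0⟩ : WeierstrassCurve ℚ).quadraticTwist
        (NumberField.discr K : ℚ)).entireLFunction 1 ≠ 0 ∧
      ¬ p ∣ NumberField.classNumber K :=
  fun _ _ hp5 _ _ _ => cruxOnSqrtSevenCorner_of_groupOrder hBT hG hp5 hp8 hp7

end Summit.BirchSwinnertonDyer.BirchSwinnertonDyer.Theorems.BiquadraticEisensteinDescentHeegnerTwistCouplingInSupplySqrtSevenCornerHecke

end
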